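import Mathlib
import HarnessLib
import Literature.MathematicalPhysics.StatisticalMechanics.ComplexGradientStiffness
import Literature.Barriers.CriticalPhenomena.RigorousRGSmallParameterGaussianIntegration
import Summits.HubbardSuperconductivity.HubbardSuperconductivity.Theorems.ComplexGFFStiffnessDefs
import Summits.HubbardSuperconductivity.HubbardSuperconductivity.Theorems.ComplexGFFStiffnessHypACumulantGaussRep
import Summits.HubbardSuperconductivity.HubbardSuperconductivity.Theorems.ComplexGFFStiffnessHypACumulantGreenSplit

/-!
# Crux `HypACumulant`, line `gnv` — gradient functionals only see the mean-zero Green's function: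
# `pertZ n K = Z_0 · E_{P_G}[∏_x (1 + K(∇φ(x)))]`

Route `route-HubbardSuperconductivity-ComplexGFFStiffness`, crux item stmt-HubbardSuperconductivity-19154,
research stub `stub_gnvOfFrd : TorusFRD 4 → GNV`.  With `A⁻¹ = G + P_0` (`…GreenSplit`) the free
measure factorises, `P_{A⁻¹} = P_G ∗ P_{P_0}` (`P_{C₁+C₂} = P_{C₁} ∗ P_{C₂}` of the tree's Gaussian
library), and under `P_{P_0}` the field is almost surely CONSTANT over the torus (its increments
have variance `P_0(x,x) − 2P_0(x,y) + P_0(y,y) = 0`).  A functional of the gradient field is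
invariant under constant shifts, so its `P_{A⁻¹}`-expectation equals its `P_G`-expectation:
`pertZ n K = Z_0 · E_{P_G}[∏_x (1 + K(∇φ(x)))]`, where `G` is exactly the covariance that the
finite-range decomposition splits as `Σ_k 𝒞_k` (`sum_circulant_eq_greenMat_of_frd`).  This is the
measure `μ^{(0)}` on zero-average fields of Adams–Buchholz–Kotecký–Müller (arXiv:1910.13564,
Ch. 6.1, (4.1)/(4.4)), reached from the model's zero-mode-massive Lebesgue integral.

## Contents (all proved; no definition, no named fact)
* `fieldGaussian_massMat_inv_eq_conv` — `P_{A⁻¹} = P_G ∗ P_{P_0}`;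
* `memLp_two_eval_fieldGaussian`, `integral_sq_sub_eval_fieldGaussian_zeroModeMat`,
  **`ae_eval_eq_eval_fieldGaussian_zeroModeMat`** — under `P_{P_0}` the field is a.s. constant;
* `integral_conv_eq_of_ae_invariant` — generic: `∫ F d(μ ∗ ν) = ∫ F dμ` when `ν`-a.e. translate
  leaves `F` invariant (`ν` a probability measure); no integrability needed;
* **`integral_fieldGaussian_massMat_inv_eq_greenMat`** — shift-invariant `F`:
  `E_{P_{A⁻¹}}[F ∘ squeeze] = E_{P_G}[F ∘ squeeze]`;
* **`pertZ_eq_mul_integral_greenMat`** — `pertZ n K = Z_0 · E_{P_G}[∏_x (1 + K(∇(squeeze φ)(x)))]`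
  for continuous `K`.

## References
* S. Adams, S. Buchholz, R. Kotecký, S. Müller, arXiv:1910.13564, Ch. 4 (4.1)/(4.4) and Ch. 6.1
  (the Gaussian measure `μ^{(0)}` on zero-average fields `𝒳_N`) [AdamsBuchholzKoteckyMuller2019].
-/

noncomputable section

-- `Summit.<Summit>.<Problem>`: single-conjunct summit, the duplicate component is mandated (D-0017).
set_option linter.dupNamespace false

namespace Summit.HubbardSuperconductivity.HubbardSuperconductivity.Theorems.ComplexGFF

open scoped BigOperators Matrix
open MeasureTheory ProbabilityTheory
open Literature.MathematicalPhysics.StatisticalMechanics.ComplexGradientGFF4 (D S)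
open Literature.Barriers.CriticalPhenomena.LongRangePhi4 (fieldGaussian fieldGaussian_add
  fieldEquiv fieldEquiv_apply componentMatrix componentMatrix_apply posSemidef_componentMatrix
  integral_fieldGaussian integral_eval_mul_eval_fieldGaussian)

/-! ### §1 A generic lemma: convolution with an invariance-preserving probability measure -/

/-- **Convolution with a measure under whose translates `F` is a.e. invariant.**  If `ν` is a
probability measure and for `ν`-a.e. `y` the translate `F(· + y)` equals `F`, then
`∫ F d(μ ∗ ν) = ∫ F dμ` (Fubini on `μ ⊗ ν`, no integrability hypothesis: both sides use the same
Bochner conventions). -/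
theorem integral_conv_eq_of_ae_invariant {X : Type*} [AddCommGroup X] [MeasurableSpace X]
    [MeasurableAdd₂ X] {E : Type*} [NormedAddCommGroup E] [NormedSpace ℝ E]
    {μ ν : Measure X} [SFinite μ] [SFinite ν] [IsProbabilityMeasure ν] {F : X → E}
    (hF : StronglyMeasurable F) (hinv : ∀ᵐ y ∂ν, ∀ x, F (x + y) = F x) :
    ∫ z, F z ∂(μ ∗ ν) = ∫ x, F x ∂μ := by
  rw [Measure.conv, integral_map (by fun_prop) hF.aestronglyMeasurable]
  have hae : (fun p : X × X => F (p.1 + p.2)) =ᵐ[μ.prod ν] fun p => F p.1 := by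
    have h := (Measure.quasiMeasurePreserving_snd (μ := μ) (ν := ν)).ae hinv
    filter_upwards [h] with p hp using hp p.1
  rw [integral_congr_ae hae, ← integral_map (f := fun x : X => F x) measurable_fst.aemeasurable
    hF.aestronglyMeasurable, Measure.map_fst_prod, measure_univ, one_smul]

/-! ### §2 `P_{A⁻¹} = P_G ∗ P_{P_0}` and the zero-mode measure is carried by constants -/

variable {n : ℕ} [NeZero n]

/-- **`P_{A⁻¹} = P_G ∗ P_{P_0}`** (`A⁻¹ = G + P_0`, both summands positive semidefinite). -/
theorem fieldGaussian_massMat_inv_eq_conv :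
    fieldGaussian (Fin 4 → ZMod n) (massMat n)⁻¹ 1 =
      fieldGaussian (Fin 4 → ZMod n) (greenMat n) 1 ∗
        fieldGaussian (Fin 4 → ZMod n) (zeroModeMat n) 1 := by
  rw [massMat_inv_eq_greenMat_add]
  exact fieldGaussian_add posSemidef_greenMat posSemidef_zeroModeMat

/-- Evaluations are square integrable under the tree's Gaussian `P_C` (any `C`). -/
theorem memLp_two_eval_fieldGaussian {Λ : Type*} [Fintype Λ] [DecidableEq Λ] {m : ℕ}
    (C : Matrix Λ Λ ℝ) (x : Λ) (i : Fin m) :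
    MemLp (fun φ : Λ → Fin m → ℝ => φ x i) 2 (fieldGaussian Λ C m) := by
  have hmeas : Measurable (fun φ : Λ → Fin m → ℝ => φ x i) :=
    (measurable_pi_apply i).comp (measurable_pi_apply x)
  rw [fieldGaussian, memLp_map_measure_iff hmeas.aestronglyMeasurable
    (fieldEquiv Λ m).measurable.aemeasurable]
  have h := IsGaussian.memLp_dual (multivariateGaussian (0 : EuclideanSpace ℝ (Λ × Fin m))
    (componentMatrix C m)) (EuclideanSpace.proj (𝕜 := ℝ) (x, i)) 2 (by simp)
  simpa [EuclideanSpace.coe_proj, Function.comp_def] using h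

/-- Under `P_{P_0}` the increments have second moment zero:
`∫ (ψ(x) − ψ(y))² dP_{P_0} = P_0(x,x) − 2 P_0(x,y) + P_0(y,y) = 0`. -/
theorem integral_sq_sub_eval_fieldGaussian_zeroModeMat (x y : Fin 4 → ZMod n) :
    ∫ ψ, (ψ x 0 - ψ y 0) ^ 2 ∂(fieldGaussian (Fin 4 → ZMod n) (zeroModeMat n) 1) = 0 := by
  set μ := fieldGaussian (Fin 4 → ZMod n) (zeroModeMat n) 1 with hμ
  have hmem : ∀ z : Fin 4 → ZMod n, MemLp (fun ψ : (Fin 4 → ZMod n) → Fin 1 → ℝ => ψ z 0) 2 μ :=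
    fun z => memLp_two_eval_fieldGaussian _ z 0
  have hint : ∀ z w : Fin 4 → ZMod n,
      Integrable (fun ψ : (Fin 4 → ZMod n) → Fin 1 → ℝ => ψ z 0 * ψ w 0) μ :=
    fun z w => (hmem z).integrable_mul (hmem w)
  have hcov : ∀ z w : Fin 4 → ZMod n, ∫ ψ, ψ z 0 * ψ w 0 ∂μ =
      ((Fintype.card (Fin 4 → ZMod n) : ℝ))⁻¹ := fun z w => by
    rw [hμ, integral_eval_mul_eval_fieldGaussian posSemidef_zeroModeMat]
    simp [zeroModeMat]
  have hexp : (fun ψ : (Fin 4 → ZMod n) → Fin 1 → ℝ => (ψ x 0 - ψ y 0) ^ 2) =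
      fun ψ => (ψ x 0 * ψ x 0 - 2 * (ψ x 0 * ψ y 0)) + ψ y 0 * ψ y 0 := by
    funext ψ; ring
  have h2 : Integrable (fun ψ : (Fin 4 → ZMod n) → Fin 1 → ℝ => 2 * (ψ x 0 * ψ y 0)) μ :=
    (hint x y).const_mul 2
  have h12 : Integrable (fun ψ : (Fin 4 → ZMod n) → Fin 1 → ℝ =>
      ψ x 0 * ψ x 0 - 2 * (ψ x 0 * ψ y 0)) μ := (hint x x).sub h2
  rw [hexp, integral_add h12 (hint y y), integral_sub (hint x x) h2, integral_const_mul, hcov, hcov,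
    hcov]
  ring

/-- **Under `P_{P_0}` the field is almost surely constant over the torus.** -/
theorem ae_eval_eq_eval_fieldGaussian_zeroModeMat :
    ∀ᵐ ψ ∂(fieldGaussian (Fin 4 → ZMod n) (zeroModeMat n) 1),
      ∀ x y : Fin 4 → ZMod n, ψ x 0 = ψ y 0 := by
  set μ := fieldGaussian (Fin 4 → ZMod n) (zeroModeMat n) 1 with hμ
  refine ae_all_iff.2 fun x => ae_all_iff.2 fun y => ?_
  have hmem : ∀ z : Fin 4 → ZMod n, MemLp (fun ψ : (Fin 4 → ZMod n) → Fin 1 → ℝ => ψ z 0) 2 μ :=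
    fun z => memLp_two_eval_fieldGaussian _ z 0
  have hint : Integrable (fun ψ : (Fin 4 → ZMod n) → Fin 1 → ℝ => (ψ x 0 - ψ y 0) ^ 2) μ := by
    have h := ((hmem x).sub (hmem y)).integrable_sq
    simpa using h
  have h0 := integral_sq_sub_eval_fieldGaussian_zeroModeMat (n := n) x y
  have hae := (integral_eq_zero_iff_of_nonneg (fun ψ => sq_nonneg _) hint).1 h0
  filter_upwards [hae] with ψ hψ
  have : (ψ x 0 - ψ y 0) ^ 2 = 0 := hψ
  exact sub_eq_zero.1 (pow_eq_zero_iff two_ne_zero |>.1 this)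

/-! ### §3 Shift-invariant functionals: `E_{P_{A⁻¹}} = E_{P_G}` -/

/-- **Gradient (shift-invariant) functionals see only the mean-zero Green's function.**  For a
strongly measurable `F` on scalar fields with `F(φ + c) = F(φ)` for every constant field `c`,
`∫ F ∘ squeeze dP_{A⁻¹} = ∫ F ∘ squeeze dP_G`. -/
theorem integral_fieldGaussian_massMat_inv_eq_greenMat {E : Type*} [NormedAddCommGroup E]
    [NormedSpace ℝ E] {F : ((Fin 4 → ZMod n) → ℝ) → E} (hF : StronglyMeasurable F)
    (hinv : ∀ (φ : (Fin 4 → ZMod n) → ℝ) (c : ℝ), F (φ + fun _ => c) = F φ) :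
    ∫ φ, F (squeeze φ) ∂(fieldGaussian (Fin 4 → ZMod n) (massMat n)⁻¹ 1) =
      ∫ φ, F (squeeze φ) ∂(fieldGaussian (Fin 4 → ZMod n) (greenMat n) 1) := by
  rw [fieldGaussian_massMat_inv_eq_conv]
  have hsq : Continuous (squeeze (n := n)) := by
    unfold squeeze; fun_prop
  refine integral_conv_eq_of_ae_invariant (hF.comp_measurable hsq.measurable) ?_
  filter_upwards [ae_eval_eq_eval_fieldGaussian_zeroModeMat (n := n)] with ψ hψ φ
  have hc : squeeze (φ + ψ) = squeeze φ + fun _ => ψ 0 0 := by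
    funext x
    simp only [squeeze, Pi.add_apply]
    rw [hψ x 0]
  rw [hc, hinv]

/-- The product of single-site gradient factors is invariant under constant shifts of the field. -/
theorem prod_one_add_shift (K : (Fin 4 → ℝ) → ℂ) (φ : (Fin 4 → ZMod n) → ℝ) (c : ℝ) :
    (∏ x : Fin 4 → ZMod n, (1 + K (fun i => D (φ + fun _ => c) i x))) =
      ∏ x : Fin 4 → ZMod n, (1 + K (fun i => D φ i x)) := by
  refine Finset.prod_congr rfl fun x _ => ?_
  congr 2
  funext i
  simp [D]

/-- **`pertZ n K = Z_0 · E_{P_G}[∏_x (1 + K(∇φ(x)))]`** for continuous `K`: the perturbed partition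
function as the free partition function times the expectation of the product of single-site
gradient factors under the Gaussian measure of the MEAN-ZERO Green's function `G` — the measure
`μ^{(0)}` on zero-average fields of the reference, whose covariance the finite-range decomposition
splits (`sum_circulant_eq_greenMat_of_frd`). -/
theorem pertZ_eq_mul_integral_greenMat {K : (Fin 4 → ℝ) → ℂ} (hK : Continuous K) :
    pertZ n K =
      ((∫ φ : (Fin 4 → ZMod n) → ℝ, Real.exp (-(S 0 φ)) : ℝ) : ℂ) *
        ∫ φ, (∏ x : Fin 4 → ZMod n, (1 + K (fun i => D (squeeze φ) i x)))
          ∂(fieldGaussian (Fin 4 → ZMod n) (greenMat n) 1) := by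
  rw [pertZ_eq_mul_integral_fieldGaussian]
  congr 1
  have hD : ∀ (i : Fin 4) (x : Fin 4 → ZMod n),
      Continuous (fun φ : (Fin 4 → ZMod n) → ℝ => D φ i x) := fun i x => by unfold D; fun_prop
  have hcont : Continuous (fun φ : (Fin 4 → ZMod n) → ℝ =>
      ∏ x : Fin 4 → ZMod n, (1 + K (fun i => D φ i x))) :=
    continuous_finsetProd _ fun x _ => continuous_const.add (hK.comp (continuous_pi fun i => hD i x))
  exact integral_fieldGaussian_massMat_inv_eq_greenMat hcont.stronglyMeasurable
    (fun φ c => prod_one_add_shift K φ c)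

end Summit.HubbardSuperconductivity.HubbardSuperconductivity.Theorems.ComplexGFF

end
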